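import Literature.NumberTheory.EllipticCurves.PotentialGoodReductionInertiaProofs
import Literature.NumberTheory.EllipticCurves.TateModuleUnipotentInertiaProofs
import Literature.NumberTheory.DiophantineGeometry.LocalReductionProofs
import Literature.NumberTheory.DiophantineGeometry.LocalReductionFiniteBadPlacesProofs
import Mathlib.NumberTheory.RamificationInertia.Valuation
import Mathlib.AlgebraicGeometry.EllipticCurve.NormalForms
import HarnessLib

/-!
# Potential good reduction at `p ≥ 5`: the wild inertia groups act trivially on the
# prime-to-`v` torsion at the places of integral `j` (Silverman *ATAEC* Thm. IV.10.2(b)), proofs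

`Proofs` file (theorems only, no definitions, no named facts) in topic
`NumberTheory/EllipticCurves`, landed by the tenured seat of bsd.S15
(`Literature.NumberTheory.EllipticCurves.conductorNorm_eq_artinConductorNat`) as a bottom-up step below Silverman *ATAEC*
Thm. IV.10.2(b), clause `p ≥ 5` (`Sw_𝔓(V_ℓ E) = 0` at `v ∤ ℓ` of residue characteristic `≥ 5`;
the named fact `swanConductorAt_rationalTate_eq_zero_of_ringChar_ne` of
`HasseWeilAbelianConductor`).  The printed proof (PDF pp. 359–362 of the held copy) treats the
places of integral `j` through Prop. IV.10.3 (good reduction over `K(E[3])`, from the criterion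
of Néron–Ogg–Shafarevich) and `#GL₂(𝔽₃) = 48`.  **This file proves the case `v(j) ≥ 0`
outright**, with the explicit Kummer extension `K(μ₁₂, ¹²√Δ)` in place of `K(E[3])` — both are
`{2, 3}`-extensions over which the curve acquires good reduction, which is all the argument uses:

* at a finite place `v ∤ 6` with `ord_v(j) ≥ 0`, over any finite extension `L ∋ δ`,
  `δ¹² = Δ` (`Δ` the discriminant of the given model), the curve has **good reduction at every
  place `w ∣ v`** (`WeierstrassCurve.hasGoodReductionAt_baseChange_of_pow_twelve_eq_Δ`: the model
  `(x, y) ↦ (δ²x, δ³y)` has `Δ' = 1`, `c₄'³ = j`, `c₆'² = j - 1728`, so its short Weierstrass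
  form `y² = x³ - (c₄'/48)x - c₆'/864` (Mathlib `toShortNF`) is `w`-integral with unit
  discriminant — a direct proof of *AEC* VII.5.5 "integral `j` ⇒ potential good reduction" at
  `p ≥ 5` (the book's proof of VII.5.4(c) uses the Legendre form instead);
  `hasGoodReductionAt_of_valuation_le_one_of_valuation_Δ_eq_one`,
  `hasGoodReductionAt_smul_iff_holds`, Mathlib `valuation_liesOver`);
  packaged as `WeierstrassCurve.exists_normal_hasGoodReductionAt_baseChange_of_valuation_j_le_one`
  (**potential good reduction for integral `j`, `v ∤ 6`**: a finite normal `E ⊆ K̄` over which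
  the curve has good reduction at every place above `v`);
* **`Gal(K(rootSet(X¹² - c))/K)` is a `{2, 3}`-group** (`c ≠ 0`): a `K`-automorphism `γ` with
  `γ^N = 1`, `gcd(N, 12) = 1`, is trivial
  (`Literature.NumberTheory.EllipticCurves.algEquiv_eq_one_of_pow_eq_one_of_eq_adjoin_rootSet`; the key step
  `Literature.NumberTheory.EllipticCurves.apply_eq_self_of_pow_twelve_eq_one` — an automorphism of odd order of any field fixes
  `μ₁₂`, because it acts on the cyclic group `μ₁₂` (`MonoidHom.map_cyclic`) through `(ℤ/d)ˣ`,
  `d ∣ 12`, of exponent `2`, `Literature.NumberTheory.EllipticCurves.ZMod.eq_one_of_pow_eq_one_of_odd_of_dvd_twelve`);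
* hence an element `σ` of a wild ramification group `Γ_K^u(𝔓)`, `u > 0`, `𝔓 ∣ v` — whose
  restriction to `E = K(rootSet(X¹² - c))` lies in `Gal(E/K)^u ≤ G_1`, a `p`-group
  (`Literature.NumberTheory.EllipticCurves.isPGroup_ramificationSubgroup_one_of_mem_primesAbove`, `TateModuleUnipotentInertiaProofs`)
  — **restricts trivially to `E`**
  (`Literature.NumberTheory.EllipticCurves.smul_eq_self_of_mem_absUpperRamificationSubgroup_of_mem_adjoin_rootSet`), lies in `I_𝔓`
  (`absUpperRamificationSubgroup_le_inertia_holds`), i.e. in the inertia group `I_𝔓 ∩ Gal(K̄/E)`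
  of `E` at `𝔓`, and therefore, for `c = Δ`, **fixes every `E[m]`, `v ∤ m`**, by *AEC*
  VII.4.1(a) over `E` (`WeierstrassCurve.smul_eq_of_mem_inertia_of_forall_smul_eq_of_nsmul_eq_zero`,
  `PotentialGoodReductionInertiaProofs`):
  `WeierstrassCurve.smul_torsion_eq_self_of_mem_absUpperRamificationSubgroup_of_valuation_j_le_one`
  — the content of Thm. IV.10.2(b), clause `p ≥ 5`, at the places of integral `j` ("the wild
  ramification groups fix `E[ℓ]`", whence `Sw_𝔓(V_ℓ E) = 0`; that step, and the assemblies with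
  the named facts of `HasseWeilAbelianWildInertia`, are carried out in its `Proofs` companion);
* `WeierstrassCurve.exists_normal_smul_torsion_eq_self_of_valuation_j_le_one_of_notMem` —
  *AEC* VII.5.5 with VII.4.1 in Galois form (the named fact
  `exists_normal_smul_torsion_eq_self_of_valuation_j_le_one` of `HasseWeilAbelianWildInertia`)
  **at the places `v ∤ 6`**: a finite normal `K''/K` inside `K̄` (namely `K(rootSet(X¹² - Δ))`)
  such that every `σ ∈ I_𝔓` restricting trivially to `K''` fixes every `E[m']`, `v ∤ m'`.  (At
  `p = 2, 3` potential good reduction needs wild extensions such as `K(E[3])`, `K(E[4])`; that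
  part remains open.)

All axioms `propext`, `Classical.choice`, `Quot.sound`.

## References

* J. H. Silverman, *Advanced Topics in the Arithmetic of Elliptic Curves*, GTM 151 (1994), §IV.10:
  Thm. 10.2(b) and its proof (PDF pp. 358–362), Prop. 10.3. [SilvermanATAEC1994]
* J. H. Silverman, *The Arithmetic of Elliptic Curves*, 2nd ed. (2009), Prop. VII.4.1,
  Prop. VII.5.4(c) and its proof, Prop. VII.5.5, VII.1 Remark 1.1, VII.5 Prop. 5.1(a), III.1
  (`c₄, c₆, Δ, j` and the short Weierstrass form). [SilvermanAEC2009]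
* J.-P. Serre, *Local Fields*, GTM 67 (1979), Ch. IV §2, Cor. 3 of Prop. 7; §3, Remark 1.
  [SerreLocalFields1979]
-/

noncomputable section

universe u

namespace Literature.NumberTheory.EllipticCurves

/-! ### Automorphisms of odd order fix the twelfth roots of unity -/

/-- In `ℤ/dℤ` with `d ∣ 12` every unit has square `1` (checked by `decide` on the six
divisors). [folklore] -/
theorem ZMod.sq_eq_one_of_mul_eq_one_of_dvd_twelve {d : ℕ} (hd : d ∣ 12) {a b : ZMod d}
    (hab : a * b = 1) : a ^ 2 = 1 := by
  have hmem : d ∈ Nat.divisors 12 := Nat.mem_divisors.mpr ⟨hd, by norm_num⟩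
  have hdiv : Nat.divisors 12 = {1, 2, 3, 4, 6, 12} := by decide
  rw [hdiv] at hmem
  simp only [Finset.mem_insert, Finset.mem_singleton] at hmem
  rcases hmem with rfl | rfl | rfl | rfl | rfl | rfl
  · exact Subsingleton.elim _ _
  · revert a b; decide
  · revert a b; decide
  · revert a b; decide
  · revert a b; decide
  · revert a b; decide

/-- In `ℤ/dℤ` with `d ∣ 12`, an element with an odd power equal to `1` is `1`. [folklore] -/
theorem ZMod.eq_one_of_pow_eq_one_of_odd_of_dvd_twelve {d : ℕ} (hd : d ∣ 12) {N : ℕ} (hN : Odd N)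
    {a : ZMod d} (ha : a ^ N = 1) : a = 1 := by
  have hsq : a ^ 2 = 1 :=
    ZMod.sq_eq_one_of_mul_eq_one_of_dvd_twelve hd (b := a ^ (N - 1))
      (by rw [← pow_succ', Nat.sub_add_cancel hN.pos, ha])
  obtain ⟨k, rfl⟩ := hN
  rw [pow_succ, pow_mul, hsq, one_pow, one_mul] at ha
  exact ha

open scoped Classical NumberField Polynomial
open Field IsDedekindDomain Polynomial

/-- **An automorphism of odd order of a field fixes every twelfth root of unity.**  The
automorphism acts on the cyclic group `μ₁₂(E)` by `x ↦ x^m` (`MonoidHom.map_cyclic`); for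
`ξ ∈ μ₁₂(E)` of order `d ∣ 12`, `ξ^{m^N} = ξ` gives `m^N ≡ 1 (mod d)`, and `N` odd forces
`m ≡ 1 (mod d)` because `(ℤ/d)ˣ` has exponent `2`. [folklore] -/
theorem apply_eq_self_of_pow_twelve_eq_one {K E : Type*} [Field K] [Field E] [Algebra K E]
    (γ : E ≃ₐ[K] E) {N : ℕ} (hN : Odd N) (hγ : γ ^ N = 1) {x : E} (hx : x ^ 12 = 1) :
    γ x = x := by
  -- the unit `ξ ∈ μ₁₂(E)` underlying `x`
  let ξ : rootsOfUnity 12 E := rootsOfUnity.mkOfPowEq x hx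
  have hξx : ((ξ : Eˣ) : E) = x := rfl
  -- `γ` acts on the cyclic group `μ₁₂(E)` as `g ↦ g ^ m`
  let f : rootsOfUnity 12 E →* rootsOfUnity 12 E :=
    restrictRootsOfUnity (γ : E ≃ₐ[K] E).toRingEquiv.toRingHom 12
  have hf_apply : ∀ g : rootsOfUnity 12 E,
      (((f g : rootsOfUnity 12 E) : Eˣ) : E) = γ ((g : Eˣ) : E) :=
    fun g ↦ restrictRootsOfUnity_coe_apply _ _
  obtain ⟨m, hm⟩ := MonoidHom.map_cyclic f
  -- iterating: `γ^k` acts as `g ↦ g ^ (m ^ k)`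
  have hiter : ∀ (k : ℕ) (g : rootsOfUnity 12 E),
      (γ ^ k) ((g : Eˣ) : E) = (((g ^ (m ^ k) : rootsOfUnity 12 E) : Eˣ) : E) := by
    intro k
    induction k with
    | zero => intro g; simp
    | succ k ih =>
      intro g
      rw [pow_succ', AlgEquiv.mul_apply, ih, ← hf_apply, hm, ← zpow_mul, ← pow_succ]
  have hN' : (γ ^ N) x = x := by rw [hγ, AlgEquiv.one_apply]
  rw [← hξx, hiter N ξ] at hN'
  -- so `ξ ^ (m ^ N) = ξ`, i.e. `ξ ^ (m ^ N - 1) = 1`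
  have h1 : ξ ^ (m ^ N - 1) = 1 := by
    rw [zpow_sub_one, mul_inv_eq_one]
    exact Subtype.ext (Units.ext hN')
  -- the order `d` of `ξ` divides `12`
  have hξ12 : ξ ^ 12 = 1 := Subtype.ext (Units.ext (by
    simp only [SubmonoidClass.coe_pow, Units.val_pow_eq_pow_val, hξx, hx]
    rfl))
  have hd12 : orderOf ξ ∣ 12 := orderOf_dvd_of_pow_eq_one hξ12
  have hd0 : orderOf ξ ≠ 0 := fun h ↦ by
    rw [h, Nat.zero_dvd] at hd12
    exact absurd hd12 (by norm_num)
  haveI : NeZero (orderOf ξ) := ⟨hd0⟩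
  have hdvd : (orderOf ξ : ℤ) ∣ m ^ N - 1 := orderOf_dvd_iff_zpow_eq_one.mpr h1
  have hmod : ((m : ZMod (orderOf ξ))) ^ N = 1 := by
    have : (((m ^ N - 1 : ℤ)) : ZMod (orderOf ξ)) = 0 :=
      (ZMod.intCast_zmod_eq_zero_iff_dvd _ _).mpr hdvd
    push_cast at this
    exact sub_eq_zero.mp this
  have hm1 : (m : ZMod (orderOf ξ)) = 1 :=
    ZMod.eq_one_of_pow_eq_one_of_odd_of_dvd_twelve hd12 hN hmod
  have hdvd1 : (orderOf ξ : ℤ) ∣ m - 1 := by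
    rw [← ZMod.intCast_zmod_eq_zero_iff_dvd]
    push_cast
    rw [hm1, sub_self]
  have h2 : ξ ^ m = ξ := by
    have := orderOf_dvd_iff_zpow_eq_one.mp hdvd1
    rwa [zpow_sub_one, mul_inv_eq_one] at this
  -- conclude
  have := hiter 1 ξ
  rw [pow_one, pow_one, h2] at this
  rw [← hξx, this]

/-! ### The Kummer field `K(rootSet(X¹² - c))` -/

/-- **The Galois group of `K(¹²√c, μ₁₂)/K` is a `{2, 3}`-group.**  For `c ≠ 0` and the subfield
`E = K(rootSet(X¹² - c))` of an extension `Ω/K` (the splitting field of `X¹² - c` when it splits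
in `Ω`): a `K`-automorphism `γ` of `E` with `γ^N = 1`, `gcd(N, 12) = 1`, is trivial.  Proof:
`N` is odd, so `γ` fixes `μ₁₂(E)` (`apply_eq_self_of_pow_twelve_eq_one`); for a root `r`,
`γ r = η r` with `η¹² = 1`, hence `γ^k r = η^k r` and `η^N = 1 = η¹²`, `η = 1`; and `E` is
generated by the roots (`IntermediateField.algHom_ext_of_eq_adjoin`).  (So `[E : K]` has no
prime factor `≥ 5`: by Cauchy's theorem an automorphism of prime order `p ≥ 5` would be
trivial.) [folklore] -/
theorem algEquiv_eq_one_of_pow_eq_one_of_eq_adjoin_rootSet {K : Type*} [Field K] {Ω : Type*}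
    [Field Ω] [Algebra K Ω] {c : K} (hc : c ≠ 0) {E : IntermediateField K Ω}
    (hE : E = IntermediateField.adjoin K ((X ^ 12 - C c : K[X]).rootSet Ω))
    (γ : E ≃ₐ[K] E) {N : ℕ} (hN : N.Coprime 12) (hγ : γ ^ N = 1) : γ = 1 := by
  have hNodd : Odd N := by
    refine Nat.odd_iff.mpr ?_
    have h : ¬ 2 ∣ N := fun h2 ↦ by
      have := Nat.dvd_gcd h2 (by norm_num : 2 ∣ 12)
      rw [Nat.Coprime.gcd_eq_one hN] at this
      omega
    omega
  -- `γ` fixes every root of `X^12 - c`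
  have hroot : ∀ (r : Ω) (hr : r ∈ (X ^ 12 - C c : K[X]).rootSet Ω),
      γ ⟨r, hE.ge (IntermediateField.subset_adjoin K _ hr)⟩ =
        ⟨r, hE.ge (IntermediateField.subset_adjoin K _ hr)⟩ := by
    intro r hr
    have hr12 : r ^ 12 = algebraMap K Ω c := by
      have := (mem_rootSet.mp hr).2
      simp only [map_sub, aeval_X_pow, aeval_C, sub_eq_zero] at this
      exact this
    have hr0 : r ≠ 0 := by
      rintro rfl
      rw [zero_pow (by norm_num)] at hr12
      exact hc ((map_eq_zero_iff _ (algebraMap K Ω).injective).mp hr12.symm)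
    set r' : E := ⟨r, hE.ge (IntermediateField.subset_adjoin K _ hr)⟩ with hr'
    have hr'0 : r' ≠ 0 := fun h ↦ hr0 (congrArg Subtype.val h)
    have hr'12 : r' ^ 12 = algebraMap K E c := Subtype.ext hr12
    set η : E := γ r' / r' with hη
    have hγr : γ r' = η * r' := by rw [hη, div_mul_cancel₀ _ hr'0]
    have hη12 : η ^ 12 = 1 := by
      rw [hη, div_pow, ← map_pow, hr'12, AlgEquiv.commutes, div_self]
      rw [map_ne_zero_iff _ (algebraMap K E).injective]
      exact hc
    have hγη : γ η = η := apply_eq_self_of_pow_twelve_eq_one γ hNodd hγ hη12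
    have hiter : ∀ k : ℕ, (γ ^ k) r' = η ^ k * r' := by
      intro k
      induction k with
      | zero => simp
      | succ k ih =>
        rw [pow_succ', AlgEquiv.mul_apply, ih, map_mul, map_pow, hγη, hγr, pow_succ]
        ring
    have hηN : η ^ N = 1 := by
      have := hiter N
      rw [hγ, AlgEquiv.one_apply] at this
      exact (mul_eq_right₀ hr'0).mp this.symm
    have hη1 : η = 1 := by
      have := pow_gcd_eq_one.mpr ⟨hηN, hη12⟩
      rwa [Nat.Coprime.gcd_eq_one hN, pow_one] at this
    rw [hγr, hη1, one_mul]
  -- `E` is generated by the roots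
  have key : (γ : E →ₐ[K] E) = AlgHom.id K E :=
    IntermediateField.algHom_ext_of_eq_adjoin K hE (fun r hr ↦ by
      rw [AlgHom.id_apply]
      exact hroot r hr)
  refine AlgEquiv.ext fun x ↦ ?_
  have := congrArg (fun f : E →ₐ[K] E ↦ f x) key
  simpa using this

/-- **An element of a wild ramification group of `K` restricts trivially to
`E = K(rootSet(X¹² - c))` at residue characteristic `p ≥ 5`.**  For a number field `K`, `c ≠ 0`,
a finite place `v ∤ 6` (residue characteristic `p ≠ 2, 3`), a prime `𝔓 ∣ v` of `\bar ℤ_K`,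
`u > 0` and `σ ∈ Γ_K^u(𝔓)`: `σ` fixes `E` pointwise.  Indeed `σ|_E` lies in
`Gal(E/K)^u ≤ G_1` (`mem_absUpperRamificationSubgroup_iff`,
`upperRamificationSubgroup_le_ramificationSubgroup_one`), a `p`-group
(`isPGroup_ramificationSubgroup_one_of_mem_primesAbove`), so `σ|_E` has order `p^t`, prime to
`12`, and is trivial by `algEquiv_eq_one_of_pow_eq_one_of_eq_adjoin_rootSet`.
[cite: SerreLocalFields1979, Ch. IV §2 Cor. 3 of Prop. 7 and §3 Remark 1] -/
theorem smul_eq_self_of_mem_absUpperRamificationSubgroup_of_mem_adjoin_rootSet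
    {K : Type u} [Field K] [NumberField K] {c : K} (hc : c ≠ 0)
    {v : HeightOneSpectrum (𝓞 K)} (h2 : (2 : 𝓞 K) ∉ v.asIdeal) (h3 : (3 : 𝓞 K) ∉ v.asIdeal)
    {𝔓 : Ideal (GaloisRepresentations.absIntegers (𝓞 K) K)} (h𝔓 : 𝔓 ∈ v.primesAbove) {u : ℝ} (hu : 0 < u)
    {σ : absoluteGaloisGroup K} (hσ : σ ∈ GaloisRepresentations.absUpperRamificationSubgroup (𝓞 K) 𝔓 u)
    {x : AlgebraicClosure K}
    (hx : x ∈ IntermediateField.adjoin K ((X ^ 12 - C c : K[X]).rootSet (AlgebraicClosure K))) :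
    σ • x = x := by
  set E : IntermediateField K (AlgebraicClosure K) :=
    IntermediateField.adjoin K ((X ^ 12 - C c : K[X]).rootSet (AlgebraicClosure K)) with hE
  haveI hsf : (X ^ 12 - C c : K[X]).IsSplittingField K E :=
    IntermediateField.adjoin_rootSet_isSplittingField (IsAlgClosed.splits _)
  haveI : Normal K E := Normal.of_isSplittingField (X ^ 12 - C c : K[X])
  haveI : FiniteDimensional K E := Polynomial.IsSplittingField.finiteDimensional E (X ^ 12 - C c : K[X])
  haveI : IsGalois K E := IsGalois.mk
  -- the residue characteristic `p` is a prime `≠ 2, 3`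
  have hp : (ringChar (𝓞 K ⧸ v.asIdeal)).Prime := by
    haveI : Finite (𝓞 K ⧸ v.asIdeal) := Ideal.finiteQuotientOfFreeOfNeBot v.asIdeal v.ne_bot
    exact CharP.char_is_prime (𝓞 K ⧸ v.asIdeal) _
  have hmem : ((ringChar (𝓞 K ⧸ v.asIdeal) : ℕ) : 𝓞 K) ∈ v.asIdeal := by
    rw [← Ideal.Quotient.eq_zero_iff_mem, map_natCast]
    exact ringChar.Nat.cast_ringChar
  have hp2 : ringChar (𝓞 K ⧸ v.asIdeal) ≠ 2 := fun h ↦ h2 (by simpa [h] using hmem)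
  have hp3 : ringChar (𝓞 K ⧸ v.asIdeal) ≠ 3 := fun h ↦ h3 (by simpa [h] using hmem)
  have hcop : (ringChar (𝓞 K ⧸ v.asIdeal)).Coprime 12 := by
    have h2' : (ringChar (𝓞 K ⧸ v.asIdeal)).Coprime 2 := (Nat.coprime_primes hp Nat.prime_two).mpr hp2
    have h3' : (ringChar (𝓞 K ⧸ v.asIdeal)).Coprime 3 :=
      (Nat.coprime_primes hp Nat.prime_three).mpr hp3
    have : (ringChar (𝓞 K ⧸ v.asIdeal)).Coprime (2 * 2 * 3) := (h2'.mul_right h2').mul_right h3'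
    simpa using this
  -- `σ|_E ∈ G_1`, a `p`-group
  have h1 : GaloisRepresentations.absRestrictNormalHom E σ ∈
      (𝔓.comap (E.integralClosureToAbsIntegers (𝓞 K))).ramificationSubgroup (E ≃ₐ[K] E) 1 :=
    GaloisRepresentations.upperRamificationSubgroup_le_ramificationSubgroup_one _ _ hu
      ((GaloisRepresentations.mem_absUpperRamificationSubgroup_iff.mp hσ) E)
  obtain ⟨t, ht⟩ := isPGroup_ramificationSubgroup_one_of_mem_primesAbove h𝔓 E ⟨_, h1⟩
  have hpow : GaloisRepresentations.absRestrictNormalHom E σ ^ ringChar (𝓞 K ⧸ v.asIdeal) ^ t = 1 := by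
    have := congrArg Subtype.val ht
    simpa using this
  have hσE : GaloisRepresentations.absRestrictNormalHom E σ = 1 :=
    algEquiv_eq_one_of_pow_eq_one_of_eq_adjoin_rootSet hc hE _ (Nat.Coprime.pow_left t hcop) hpow
  -- hence `σ` fixes `E` pointwise
  have hcomm := AlgEquiv.restrictNormal_commutes (absoluteGaloisGroup.toAlgEquiv K σ) E ⟨x, hx⟩
  have hres : (absoluteGaloisGroup.toAlgEquiv K σ).restrictNormal E = GaloisRepresentations.absRestrictNormalHom E σ := rfl
  rw [hres, hσE, AlgEquiv.one_apply] at hcomm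
  rw [absoluteGaloisGroup.smul_def]
  exact hcomm.symm

end Literature.NumberTheory.EllipticCurves

namespace WeierstrassCurve

open scoped Classical NumberField Polynomial
open Literature.NumberTheory.GaloisRepresentations Literature.NumberTheory.EllipticCurves Field IsDedekindDomain Polynomial

section GoodReduction

variable {K : Type*} [Field K] [NumberField K] (W : WeierstrassCurve K)

/-- A natural number prime to `v` is a `v`-adic unit. [folklore] -/
theorem valuation_natCast_eq_one_of_natCast_notMem {v : HeightOneSpectrum (𝓞 K)} {q : ℕ}
    (hq : (q : 𝓞 K) ∉ v.asIdeal) : v.valuation K (q : K) = 1 := by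
  have hle : v.valuation K (q : K) ≤ 1 := by
    simpa using v.valuation_le_one (K := K) (q : 𝓞 K)
  have hlt : ¬ v.valuation K (q : K) < 1 := by
    simpa using (v.valuation_lt_one_iff_mem (K := K) (q : 𝓞 K)).not.mpr hq
  exact le_antisymm hle (not_lt.mp hlt)

omit [NumberField K] in
/-- A natural number prime to `v` is prime to every place `w ∣ v` of a finite extension.
[folklore] -/
theorem natCast_notMem_of_under_eq {L : Type*} [Field L] [Algebra K L]
    {v : HeightOneSpectrum (𝓞 K)} {w : HeightOneSpectrum (𝓞 L)}
    (hw : w.asIdeal.under (𝓞 K) = v.asIdeal) {q : ℕ} (hq : (q : 𝓞 K) ∉ v.asIdeal) :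
    (q : 𝓞 L) ∉ w.asIdeal := by
  intro h
  apply hq
  have : (q : 𝓞 L) = algebraMap (𝓞 K) (𝓞 L) q := by simp
  rw [this] at h
  rw [← hw, Ideal.under_def, Ideal.mem_comap]
  exact h

/-- **Good reduction over `K(¹²√Δ)` at the places of integral `j` and residue characteristic
`≥ 5`** — a direct proof of the implication "integral `j` ⇒ potential good reduction" of
Silverman *AEC* Prop. VII.5.5 at `p ≥ 5`, with the twelfth root of `Δ` in place of the
Legendre form used in the printed proof of Prop. VII.5.4(c).  Let `E/K` be an elliptic curve
over a number field with discriminant `Δ`, `L/K` a finite extension containing `δ` with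
`δ¹² = Δ`, `v` a finite place of `K` with `ord_v(j) ≥ 0` and `v ∤ 6`, and `w ∣ v` a place of
`L`.  Then `E` has good reduction at `w`: the model `(x, y) ↦ (δ²x, δ³y)` has `Δ' = 1`,
`c₄'³ = j`, `c₆'² = j - 1728`, so its short Weierstrass form `y² = x³ - (c₄'/48) x - c₆'/864`
(Mathlib `toShortNF`) is `w`-integral with unit discriminant
(`hasGoodReductionAt_of_valuation_le_one_of_valuation_Δ_eq_one`, `hasGoodReductionAt_smul_iff_holds`).
[cite: SilvermanAEC2009, Prop. VII.5.5 (integral j ⇒ potential good reduction), VII.1 Remark 1.1, VII.5 Prop. 5.1(a), III.1 (c₄, c₆, Δ, j)] -/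
theorem hasGoodReductionAt_baseChange_of_pow_twelve_eq_Δ [W.IsElliptic]
    (L : Type*) [Field L] [NumberField L] [Algebra K L] {δ : L}
    (hδ : δ ^ 12 = algebraMap K L W.Δ)
    {v : HeightOneSpectrum (𝓞 K)} (hj : v.valuation K W.j ≤ 1)
    (h2 : (2 : 𝓞 K) ∉ v.asIdeal) (h3 : (3 : 𝓞 K) ∉ v.asIdeal)
    {w : HeightOneSpectrum (𝓞 L)} (hw : w.asIdeal.under (𝓞 K) = v.asIdeal) :
    (W.baseChange L).HasGoodReductionAt w := by
  haveI : w.asIdeal.LiesOver v.asIdeal := ⟨hw.symm⟩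
  -- `2`, `3` are `w`-units
  have h2u : w.valuation L (2 : L) = 1 := by
    simpa using valuation_natCast_eq_one_of_natCast_notMem (K := L) (q := 2)
      (by simpa using natCast_notMem_of_under_eq hw (q := 2) (by simpa using h2))
  have h3u : w.valuation L (3 : L) = 1 := by
    simpa using valuation_natCast_eq_one_of_natCast_notMem (K := L) (q := 3)
      (by simpa using natCast_notMem_of_under_eq hw (q := 3) (by simpa using h3))
  have h48 : w.valuation L (48 : L) = 1 := by
    rw [show (48 : L) = 2 ^ 4 * 3 by norm_num, map_mul, map_pow, h2u, h3u]; simp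
  have h864 : w.valuation L (864 : L) = 1 := by
    rw [show (864 : L) = 2 ^ 5 * 3 ^ 3 by norm_num, map_mul, map_pow, map_pow, h2u, h3u]; simp
  have h1728 : w.valuation L (1728 : L) = 1 := by
    rw [show (1728 : L) = 2 ^ 6 * 3 ^ 3 by norm_num, map_mul, map_pow, map_pow, h2u, h3u]; simp
  -- `j` is `w`-integral
  set WL := W.baseChange L with hWL
  haveI hWLell : WL.IsElliptic := inferInstanceAs (W.map (algebraMap K L)).IsElliptic
  have hjL : WL.j = algebraMap K L W.j := W.map_j (algebraMap K L)
  have hjw : w.valuation L WL.j ≤ 1 := by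
    rw [hjL, ← HeightOneSpectrum.valuation_liesOver L v w]
    exact pow_le_one₀ zero_le hj
  -- the rescaled model `W₁ = (δ, 0, 0, 0) • W_L`, `Δ₁ = 1`
  have hΔ0 : (algebraMap K L W.Δ) ≠ 0 := by
    rw [_root_.map_ne_zero]; exact W.isUnit_Δ.ne_zero
  have hδ0 : δ ≠ 0 := by
    rintro rfl
    rw [zero_pow (by norm_num)] at hδ
    exact hΔ0 hδ.symm
  set C₁ : VariableChange L := ⟨Units.mk0 δ hδ0, 0, 0, 0⟩ with hC₁
  set W₁ := C₁ • WL with hW₁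
  haveI hW₁ell : W₁.IsElliptic := inferInstanceAs (C₁ • WL).IsElliptic
  have hC₁u : (↑C₁.u⁻¹ : L) = δ⁻¹ := by rw [Units.val_inv_eq_inv_val, hC₁, Units.val_mk0]
  have hΔL : WL.Δ = algebraMap K L W.Δ := by rw [hWL, baseChange, map_Δ]
  have hΔ₁ : W₁.Δ = 1 := by
    rw [hW₁, variableChange_Δ, hC₁u, hΔL, ← hδ, inv_pow, inv_mul_cancel₀ (pow_ne_zero _ hδ0)]
  have hj₁ : W₁.j = WL.j := WL.variableChange_j C₁
  -- `c₄₁³ = j`, `c₆₁² = j - 1728`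
  have hc4cube : W₁.c₄ ^ 3 = W₁.j := by
    have hΔ'1 : W₁.Δ' = 1 := Units.ext (by rw [coe_Δ', hΔ₁, Units.val_one])
    rw [j, hΔ'1, inv_one, Units.val_one, one_mul]
  have hc4 : w.valuation L W₁.c₄ ≤ 1 := by
    rw [← pow_le_one_iff three_ne_zero, ← map_pow, hc4cube, hj₁]
    exact hjw
  have hc6 : w.valuation L W₁.c₆ ≤ 1 := by
    have hrel : W₁.c₆ ^ 2 = W₁.c₄ ^ 3 - 1728 * W₁.Δ := by rw [c_relation]; ring
    rw [← pow_le_one_iff two_ne_zero, ← map_pow, hrel, hΔ₁, mul_one]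
    refine le_trans (Valuation.map_sub _ _ _) (max_le ?_ ?_)
    · rw [hc4cube, hj₁]; exact hjw
    · rw [h1728]
  -- the short model `S = toShortNF • W₁`: `a₁ = a₂ = a₃ = 0`, `c₄ = -48 a₄`, `c₆ = -864 a₆`
  letI : Invertible (2 : L) := invertibleOfNonzero two_ne_zero
  letI : Invertible (3 : L) := invertibleOfNonzero three_ne_zero
  set S := W₁.toShortNF • W₁ with hS
  haveI : S.IsShortNF := W₁.toShortNF_spec
  have hSu : W₁.toShortNF.u = 1 := by
    simp [toShortNF, toCharNeTwoNF, VariableChange.mul_def]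
  have hSu' : (↑W₁.toShortNF.u⁻¹ : L) = 1 := by rw [hSu, inv_one, Units.val_one]
  have hSc4 : S.c₄ = W₁.c₄ := by rw [hS, variableChange_c₄, hSu', one_pow, one_mul]
  have hSc6 : S.c₆ = W₁.c₆ := by rw [hS, variableChange_c₆, hSu', one_pow, one_mul]
  have hSΔ : S.Δ = 1 := by rw [hS, variableChange_Δ, hSu', one_pow, one_mul, hΔ₁]
  have ha4 : w.valuation L S.a₄ ≤ 1 := by
    have h : w.valuation L S.a₄ = w.valuation L S.c₄ := by
      rw [S.c₄_of_isShortNF, map_mul, Valuation.map_neg, h48, one_mul]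
    rw [h, hSc4]; exact hc4
  have ha6 : w.valuation L S.a₆ ≤ 1 := by
    have h : w.valuation L S.a₆ = w.valuation L S.c₆ := by
      rw [S.c₆_of_isShortNF, map_mul, Valuation.map_neg, h864, one_mul]
    rw [h, hSc6]; exact hc6
  have hgoodS : S.HasGoodReductionAt w :=
    S.hasGoodReductionAt_of_valuation_le_one_of_valuation_Δ_eq_one w
      (by rw [S.a₁_of_isShortNF, map_zero]; exact zero_le)
      (by rw [S.a₂_of_isShortNF, map_zero]; exact zero_le)
      (by rw [S.a₃_of_isShortNF, map_zero]; exact zero_le) ha4 ha6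
      (by rw [hSΔ, map_one])
  -- transport back along the two changes of variables
  have hgood₁ : W₁.HasGoodReductionAt w := (hasGoodReductionAt_smul_iff_holds w W₁ _).mp hgoodS
  exact (hasGoodReductionAt_smul_iff_holds w WL C₁).mp hgood₁

end GoodReduction

section NumberField

variable {K : Type u} [Field K] [NumberField K] (W : WeierstrassCurve K)

/-- **Potential good reduction for integral `j` at `p ≥ 5`** (Silverman *AEC* Prop. VII.5.5,
"integral `j` ⇒ potential good reduction", at the places `v ∤ 6`, in the tree's global
rendering): there is a finite normal subextension `E/K` of `K̄` — namely
`E = K(rootSet(X¹² - Δ))` — over which the curve has good reduction at every place above `v`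
(`hasGoodReductionAt_baseChange_of_pow_twelve_eq_Δ`).
[cite: SilvermanAEC2009, Prop. VII.5.5 (integral j ⇒ potential good reduction)] -/
theorem exists_normal_hasGoodReductionAt_baseChange_of_valuation_j_le_one [W.IsElliptic]
    (v : HeightOneSpectrum (𝓞 K)) (hj : v.valuation K W.j ≤ 1)
    (h2 : (2 : 𝓞 K) ∉ v.asIdeal) (h3 : (3 : 𝓞 K) ∉ v.asIdeal) :
    ∃ (E : IntermediateField K (AlgebraicClosure K)) (_ : FiniteDimensional K E) (_ : Normal K E)
      (_ : NumberField E),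
      ∀ w : HeightOneSpectrum (𝓞 E), w.asIdeal.under (𝓞 K) = v.asIdeal →
        (W.baseChange E).HasGoodReductionAt w := by
  set E : IntermediateField K (AlgebraicClosure K) :=
    IntermediateField.adjoin K ((X ^ 12 - C W.Δ : K[X]).rootSet (AlgebraicClosure K)) with hE
  haveI hsf : (X ^ 12 - C W.Δ : K[X]).IsSplittingField K E :=
    IntermediateField.adjoin_rootSet_isSplittingField (IsAlgClosed.splits _)
  haveI hN : Normal K E := Normal.of_isSplittingField (X ^ 12 - C W.Δ : K[X])
  haveI hF : FiniteDimensional K E :=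
    Polynomial.IsSplittingField.finiteDimensional E (X ^ 12 - C W.Δ : K[X])
  haveI hNF : NumberField E := NumberField.of_module_finite K E
  obtain ⟨δ, hδ⟩ := IsAlgClosed.exists_pow_nat_eq (algebraMap K (AlgebraicClosure K) W.Δ)
    (by norm_num : 0 < 12)
  have hδE : δ ∈ E := IntermediateField.subset_adjoin K _
    (mem_rootSet.mpr ⟨X_pow_sub_C_ne_zero (by norm_num) _, by simp [hδ]⟩)
  have hδ' : (⟨δ, hδE⟩ : E) ^ 12 = algebraMap K E W.Δ := Subtype.ext hδ
  exact ⟨E, hF, hN, hNF, fun w hw ↦ W.hasGoodReductionAt_baseChange_of_pow_twelve_eq_Δ E hδ' hj h2 h3 hw⟩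

/-- **Wild inertia acts trivially on the prime-to-`v` torsion at the places of integral `j` and
residue characteristic `≥ 5`** — the content of Silverman *ATAEC* Thm. IV.10.2(b), clause
`p ≥ 5`, case `v(j) ≥ 0`, **proved** (in place of the book's route through Prop. IV.10.3 and
`#GL₂(𝔽₃) = 48`): over the finite Galois extension `E = K(rootSet(X¹² - Δ)) ⊆ K̄` the curve
has good reduction at every place above `v`
(`hasGoodReductionAt_baseChange_of_pow_twelve_eq_Δ`), an element `σ` of a wild ramification
group `Γ_K^u(𝔓)`, `u > 0`, restricts trivially to `E`
(`Literature.NumberTheory.EllipticCurves.smul_eq_self_of_mem_absUpperRamificationSubgroup_of_mem_adjoin_rootSet`) and lies in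
`I_𝔓` (`absUpperRamificationSubgroup_le_inertia_holds`), hence lies in the inertia group of `E`
at `𝔓` and fixes `E[m]`, `v ∤ m`, by *AEC* VII.4.1(a) over `E`
(`smul_eq_of_mem_inertia_of_forall_smul_eq_of_nsmul_eq_zero`, `PotentialGoodReductionInertiaProofs`).
[cite: SilvermanATAEC1994, Thm. IV.10.2(b), case of integral j (PDF pp. 360–362)]
[cite: SilvermanAEC2009, Prop. VII.5.5 with Prop. VII.4.1(a)] -/
theorem smul_torsion_eq_self_of_mem_absUpperRamificationSubgroup_of_valuation_j_le_one
    [W.IsElliptic] {v : HeightOneSpectrum (𝓞 K)} (hj : v.valuation K W.j ≤ 1)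
    (h2 : (2 : 𝓞 K) ∉ v.asIdeal) (h3 : (3 : 𝓞 K) ∉ v.asIdeal)
    {𝔓 : Ideal (absIntegers (𝓞 K) K)} (h𝔓 : 𝔓 ∈ v.primesAbove) {u : ℝ} (hu : 0 < u)
    {σ : absoluteGaloisGroup K} (hσ : σ ∈ absUpperRamificationSubgroup (𝓞 K) 𝔓 u)
    {m : ℕ} (hm : (m : 𝓞 K) ∉ v.asIdeal) (P : geomPoints W) (hP : m • P = 0) : σ • P = P := by
  have hΔ : W.Δ ≠ 0 := W.isUnit_Δ.ne_zero
  set E : IntermediateField K (AlgebraicClosure K) :=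
    IntermediateField.adjoin K ((X ^ 12 - C W.Δ : K[X]).rootSet (AlgebraicClosure K)) with hE
  haveI hsf : (X ^ 12 - C W.Δ : K[X]).IsSplittingField K E :=
    IntermediateField.adjoin_rootSet_isSplittingField (IsAlgClosed.splits _)
  haveI : Normal K E := Normal.of_isSplittingField (X ^ 12 - C W.Δ : K[X])
  haveI : FiniteDimensional K E :=
    Polynomial.IsSplittingField.finiteDimensional E (X ^ 12 - C W.Δ : K[X])
  haveI : NumberField E := NumberField.of_module_finite K E
  -- `σ` fixes `E` pointwise and lies in `I_𝔓`
  have hfix : ∀ x : AlgebraicClosure K, x ∈ E → σ • x = x := fun x hx ↦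
    smul_eq_self_of_mem_absUpperRamificationSubgroup_of_mem_adjoin_rootSet hΔ h2 h3 h𝔓 hu hσ hx
  have hσI : σ ∈ 𝔓.inertia (absoluteGaloisGroup K) :=
    absUpperRamificationSubgroup_le_inertia_holds (𝓞 K) 𝔓 u hσ
  -- a root `δ ∈ E` of `X^12 - Δ`; good reduction over `E` above `v`
  obtain ⟨δ, hδ⟩ := IsAlgClosed.exists_pow_nat_eq (algebraMap K (AlgebraicClosure K) W.Δ)
    (by norm_num : 0 < 12)
  have hδE : δ ∈ E := IntermediateField.subset_adjoin K _
    (mem_rootSet.mpr ⟨X_pow_sub_C_ne_zero (by norm_num) _, by simp [hδ]⟩)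
  have hδ' : (⟨δ, hδE⟩ : E) ^ 12 = algebraMap K E W.Δ := Subtype.ext hδ
  have hgood : ∀ w : HeightOneSpectrum (𝓞 E), w.asIdeal.under (𝓞 K) = v.asIdeal →
      (W.baseChange E).HasGoodReductionAt w := fun w hw ↦
    W.hasGoodReductionAt_baseChange_of_pow_twelve_eq_Δ E hδ' hj h2 h3 hw
  exact W.smul_eq_of_mem_inertia_of_forall_smul_eq_of_nsmul_eq_zero E hgood hm h𝔓 hσI hfix hP

/-- **Potential good reduction for integral `j` (Silverman *AEC* VII.5.5 with VII.4.1(b)),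
Galois form, proved at residue characteristic `≥ 5`.**  The named fact
`exists_normal_smul_torsion_eq_self_of_valuation_j_le_one W` of `HasseWeilAbelianWildInertia`
restricted to the places `v ∤ 6` (`2, 3 ∉ v`): for `ord_v(j) ≥ 0` there is a finite normal `K''/K` inside
`K̄` — namely `K'' = K(rootSet(X¹² - Δ))` — such that every `σ ∈ I_𝔓` restricting trivially to
`K''` fixes every `E[m']`, `v ∤ m'`.  (At `p = 2, 3` potential good reduction needs wild
extensions such as `K(E[3])`, `K(E[4])`; that part of the fact remains open.)
[cite: SilvermanAEC2009, Prop. VII.5.5 and Prop. VII.5.4, with Prop. VII.4.1] -/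
theorem exists_normal_smul_torsion_eq_self_of_valuation_j_le_one_of_notMem [W.IsElliptic]
    (v : HeightOneSpectrum (𝓞 K)) (hj : v.valuation K W.j ≤ 1)
    (h2 : (2 : 𝓞 K) ∉ v.asIdeal) (h3 : (3 : 𝓞 K) ∉ v.asIdeal)
    {𝔓 : Ideal (absIntegers (𝓞 K) K)} (h𝔓 : 𝔓 ∈ v.primesAbove) :
    ∃ (E : IntermediateField K (AlgebraicClosure K)) (_ : FiniteDimensional K E) (_ : Normal K E),
      ∀ {σ : absoluteGaloisGroup K} (_hσI : σ ∈ 𝔓.inertia (absoluteGaloisGroup K))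
        (_hσE : σ ∈ (absRestrictNormalHom E).ker)
        {m' : ℕ} (_hm' : (m' : 𝓞 K) ∉ v.asIdeal) (P : geomPoints W), m' • P = 0 → σ • P = P := by
  have hΔ : W.Δ ≠ 0 := W.isUnit_Δ.ne_zero
  set E : IntermediateField K (AlgebraicClosure K) :=
    IntermediateField.adjoin K ((X ^ 12 - C W.Δ : K[X]).rootSet (AlgebraicClosure K)) with hE
  haveI hsf : (X ^ 12 - C W.Δ : K[X]).IsSplittingField K E :=
    IntermediateField.adjoin_rootSet_isSplittingField (IsAlgClosed.splits _)
  haveI hN : Normal K E := Normal.of_isSplittingField (X ^ 12 - C W.Δ : K[X])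
  haveI hF : FiniteDimensional K E :=
    Polynomial.IsSplittingField.finiteDimensional E (X ^ 12 - C W.Δ : K[X])
  haveI : NumberField E := NumberField.of_module_finite K E
  refine ⟨E, hF, hN, fun {σ} hσI hσE {m'} hm' P hP ↦ ?_⟩
  -- `σ` fixes `E` pointwise
  have hfix : ∀ x : AlgebraicClosure K, x ∈ E → σ • x = x := by
    intro x hx
    have hcomm := AlgEquiv.restrictNormal_commutes (absoluteGaloisGroup.toAlgEquiv K σ) E ⟨x, hx⟩
    have hres : (absoluteGaloisGroup.toAlgEquiv K σ).restrictNormal E = absRestrictNormalHom E σ :=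
      rfl
    rw [hres, (MonoidHom.mem_ker).mp hσE, AlgEquiv.one_apply] at hcomm
    rw [absoluteGaloisGroup.smul_def]
    exact hcomm.symm
  -- good reduction over `E` above `v`
  obtain ⟨δ, hδ⟩ := IsAlgClosed.exists_pow_nat_eq (algebraMap K (AlgebraicClosure K) W.Δ)
    (by norm_num : 0 < 12)
  have hδE : δ ∈ E := IntermediateField.subset_adjoin K _
    (mem_rootSet.mpr ⟨X_pow_sub_C_ne_zero (by norm_num) _, by simp [hδ]⟩)
  have hδ' : (⟨δ, hδE⟩ : E) ^ 12 = algebraMap K E W.Δ := Subtype.ext hδ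
  have hgood : ∀ w : HeightOneSpectrum (𝓞 E), w.asIdeal.under (𝓞 K) = v.asIdeal →
      (W.baseChange E).HasGoodReductionAt w := fun w hw ↦
    W.hasGoodReductionAt_baseChange_of_pow_twelve_eq_Δ E hδ' hj h2 h3 hw
  exact W.smul_eq_of_mem_inertia_of_forall_smul_eq_of_nsmul_eq_zero E hgood hm' h𝔓 hσI hfix hP

end NumberField

end WeierstrassCurve

end
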